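import Summits.BirchSwinnertonDyer.BirchSwinnertonDyer.Theorems.ClassRecordThreeCornerAtThreeUpperModEightOfTwinLower
import Summits.BirchSwinnertonDyer.BirchSwinnertonDyer.Theorems.ClassRecordThreeCornerAtThreeChaStructureOfImage
import HarnessLib

/-!
# Routes `ClassRecordThree` ∕ `KolyvaginRoadThree` (rung K2@3), crux `CornerAtThreeW` (item stmt-BirchSwinnertonDyer-21420; 19111 aside),
# conjunct (U), MONO-carrier branch: lane A's Jetchev-MAX END with the cited structure fact `hChaU`
# (`Cha2005.rmk25_padicValNat_card_sha_primary_add_le_of_globalDivisibility`) REPLACED by its KERNEL derivation at `p = 3`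
# (`ModularHeegnerCha.cha_rmk25_upper_three_of_casselsTate_of_frobeniusCongruence`, this seat g11) — the branch now rests on the
# Cassels–Tate level inputs (`casselsTate_levelInputs`, ALREADY conjunct 1 of the line's `stub_upper3_inertDisplay`) and Gross's Prop. 3.7 (2)
# (ALREADY `h37`) instead of Cha 2005 Rmk. 25 (cell `bsd-stepL`, seat `bsd-stepL-corner3-p2` g11 = WIDTH-LEVER lane B; `--supports … --as helper`)

THEOREMS ONLY (no definition, no named fact, no `sorry`). The four theorems are lane B g6's `…CornerAtThreeUpperModEightOfTwinLower` (itself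
corner-p1 g12's chain re-keyed on the twin half) VERBATIM with the binder `hChaU` replaced by `hCT : ∀ K, casselsTate_levelInputs K` (+ `h37` where it
was not yet a binder); the ONE changed proof line is the call of corner-p1's §1 `Koly.shaIndexBound_sharp_of_globalDivisibility_of_irreducible hChaU …`,
now §0 `Koly.shaIndexBound_sharp_of_globalDivisibility_three_of_casselsTate …` — corner-p1's §1 with Cha's fact replaced by the kernel theorem (its
extra side conditions «`2` not inert», «`3` split» are read off the frame: `d_K ≡ 1 (mod 8)`, `3 ∣ N` + Heegner). EFFECT on the line of record
(`Cruxes/CornerAtThreeW/Lines/inert.lean` r10 → r11): the mono branch of `residual3_of_stubs` no longer consumes the conjunct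
`Cha2005.rmk25_padicValNat_card_sha_primary_add_le_of_globalDivisibility` of `stub_cornerFacts3` — one XL named fact FEWER on the (U)-side.

HONEST FRAMING: CONDITIONAL on NAMED, published, typed, unformalised facts (Gross 3.7 (2) ∕ Nekovář 4.13 (ii); the canonical Poitou–Tate feed;
GZ86 III (3.1) image-free — for the Jetchev walk; the Cassels–Tate level inputs — for the structure bound) and on the supplied twin half; no stub is
discharged; 19111 ∕ 21420 stay OPEN; nothing about any curve's BSD; T7. Credit: corner-p1 g10–g12 (the chain), x11b3, tam3-p1, lane B g5–g11.
References (locators only): [cite: GrossLMS1991, Prop. 3.7 (2) (p. 240)] [cite: Nekovar2007, Prop. 4.13 (ii)] [cite: Jetchev2008, Thm. 1.4, §5–§6]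
[cite: McCallumLMS1991, §5 Lemma 5.1, Cor. 5.6] [cite: GrossZagier1986, III (3.1)] [cite: MilneADT2006, Ch. I, Thm. 4.10(b), §6 Thm. 6.13(a)]
[cite: Cha2005, Thm. 21, Rmk. 25 (the statement now derived)].
-/

set_option autoImplicit false
set_option linter.dupNamespace false -- `Summit.BirchSwinnertonDyer.BirchSwinnertonDyer` (summit = problem), tree-wide

noncomputable section

open scoped Classical NumberField

/-! ### §0 Corner-p1's §1 at `p = 3` with Cha's fact replaced by the kernel theorem -/

namespace Summit.BirchSwinnertonDyer.Rank1Residual.X11b.Three.Koly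

open WeierstrassCurve Literature.NumberTheory.EllipticCurves
  Literature.NumberTheory.EllipticCurves.ModularForms
  Literature.NumberTheory.EllipticCurves.Rank1Residual
  Literature.NumberTheory.EllipticCurves.Rank1Residual.Typed
  Literature.NumberTheory.GaloisRepresentations Literature.NumberTheory.GaloisCohomology
  Summit.BirchSwinnertonDyer.Rank1Residual Summit.BirchSwinnertonDyer.Rank1Residual.X11b
  Summit.BirchSwinnertonDyer.BirchSwinnertonDyer.Theorems

/-- **UPPER at `p = 3`: the Tamagawa-sharpened Kolyvagin bound over `K` from global divisibility (one frame), for IRREDUCIBLE `ρ̄_{E,3}`,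
WITHOUT Cha's fact.** Corner-p1 g2's `shaIndexBound_sharp_of_globalDivisibility_of_irreducible` at `p = 3` VERBATIM except that the binder
`hChaU` is replaced by the Cassels–Tate level inputs at `K` (`hCT`), Gross's Prop. 3.7 (2) image-free (`h372`) and the frame condition
`d_K ≡ 1 (mod 8)` (`hd8`; `2` splits), the structure bound being this seat's KERNEL theorem
`ModularHeegnerCha.cha_rmk25_upper_three_of_casselsTate_of_frobeniusCongruence` (`3` splits in `K`: `3 ∣ N` + Heegner). CONDITIONAL on
`hCT`, `h372`, `hglob`. [cite: McCallumLMS1991, §5 Cor. 5.6 (p. 310) and Lemma 5.1 (p. 303)] [cite: Cha2005, Thm. 21 and Rmk. 25 (derived)] -/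
theorem shaIndexBound_sharp_of_globalDivisibility_three_of_casselsTate
    (W : WeierstrassCurve ℚ) [W.IsElliptic] [W.IsGloballyMinimal] [NeZero (W.conductorNorm ℤ)]
    (K : Type) [Field K] [NumberField K] [Fact (Nat.Prime 3)]
    (hCT : casselsTate_levelInputs K) (h372 : GrossLMS1991.prop37_2_frobeniusCongruence)
    (hmult : W.HasMultiplicativeReductionAtPrime 3) (hirr : Irr W 3)
    (hK : IsImaginaryQuadratic K) (hd8 : NumberField.discr K % 8 = 1)
    (h3 : NumberField.discr K ≠ -3) (h4 : NumberField.discr K ≠ -4)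
    (hHN : SatisfiesHeegnerHypothesis (W.conductorNorm ℤ) K)
    (Dt : ModularParametrizationData W (W.conductorNorm ℤ)) (β : ℤ) (ι : K →+* ℂ)
    (d₁ : KolyvaginHeegnerData Dt β ι 1) (P : (W.baseChange K).toAffine.Point)
    (hPd : d₁.toGeomPoints d₁.derivedPoint = toGeomPoints (W.baseChange K) P)
    (hPinf : ¬ IsOfFinAddOrder P)
    (hrank : (W.baseChange K).mordellWeilRank = 1)
    (hiv : ∀ x : (W.baseChange K).toAffine.Point, 3 • x = 0 → x = 0)
    [Finite (W.baseChange K).sha] {t : ℕ}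
    (hglob : ∀ (s : ℕ), s ≤ t → ∀ (n : ℕ) (d : KolyvaginHeegnerData Dt β ι n), Squarefree n →
      (∀ ℓ ∈ n.primeFactors, Zhang2014.IsKolyvaginPrime (W.conductorNorm ℤ) W K 3 ℓ ∧
        s ≤ Zhang2014.kolyvaginIndex W 3 ℓ) → PDiv d 3 s) :
    padicValNat 3 (Nat.card (W.baseChange K).sha) + 2 * t ≤
      2 * padicValNat 3 (AddSubgroup.zmultiples P).index := by
  have hp : (3 : ℕ).Prime := Fact.out
  -- the frame: `3 ∣ N` splits in `K` (Heegner), `2` splits (`d_K ≡ 1 (mod 8)`)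
  have hpN : 3 ∣ W.conductorNorm ℤ :=
    (W.dvd_conductorNorm_iff_not_hasGoodReductionAtPrime 3).mpr
      (WeierstrassCurve.HasMultiplicativeReduction.not_hasGoodReduction (R := ℤ_[3]) hmult)
  have h3split : ((Ideal.span {((3 : ℕ) : ℤ)}).primesOver (𝓞 K)).ncard = 2 := hHN 3 hp hpN
  have h2 : ¬ (Ideal.span {((2 : ℕ) : 𝓞 K)}).IsPrime := by
    rw [Nat.cast_ofNat]
    exact not_isPrime_span_two_of_discr_mod_eight_eq_one hK.1 hd8
  -- the exponent `3^{M₀} ∥ P` (Mordell–Weil)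
  haveI : Module.Finite ℤ (W.baseChange K).toAffine.Point := (W.baseChange K).module_finite_point_holds
  obtain ⟨M₀, x₀, hx₀, hmax⟩ := exists_pow_smul_eq_and_forall_ne hPinf (p := 3) hp.two_le
  have hdiv : ∃ Q : (W.baseChange K).toAffine.Point, ((3 ^ M₀ : ℕ) : ℤ) • Q = P :=
    ⟨x₀, by rw [natCast_zsmul]; exact hx₀⟩
  have hndiv : ¬ ∃ Q : (W.baseChange K).toAffine.Point, ((3 ^ (M₀ + 1) : ℕ) : ℤ) • Q = P := by
    rintro ⟨Q, hQ⟩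
    exact hmax Q (by rw [← natCast_zsmul]; exact hQ)
  -- the structure theorem under irreducibility, upper form — THE KERNEL THEOREM (this seat g11) in place of Cha's fact
  have hle : padicValNat 3 (Nat.card (AddCommGroup.primaryComponent (W.baseChange K).sha 3)) + 2 * t ≤
      2 * M₀ :=
    ModularHeegnerCha.cha_rmk25_upper_three_of_casselsTate_of_frobeniusCongruence hCT h372 hK h3 h4 hHN h2
      h3split hirr ι Dt d₁ hPd hPinf hdiv hndiv t (fun s hs n d hn hℓ ↦ hglob s hs n d hn hℓ)
  -- `ord₃ #Ш = ord₃ #Ш[3^∞]` and `ord₃ [E(K):ℤP] = M₀`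
  have hsha : padicValNat 3 (Nat.card (AddCommGroup.primaryComponent (W.baseChange K).sha 3)) =
      padicValNat 3 (Nat.card (W.baseChange K).sha) :=
    padicValNat_card_addPrimaryComponent (A := (W.baseChange K).sha) 3
  haveI : Finite (AddCommGroup.torsion (W.baseChange K).toAffine.Point) :=
    WeierstrassCurve.finite_torsion_point (W := W.baseChange K)
  obtain ⟨c, Q, hcQ, hcker⟩ := RankOne.exists_coord_of_mordellWeilRank_eq_one (W.baseChange K) hrank
  have hidx : padicValNat 3 (AddSubgroup.zmultiples P).index = M₀ :=
    padicValNat_index_zmultiples_eq_of_divisibility c Q hcQ hcker hiv P hdiv hndiv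
  rw [hidx, ← hsha]
  exact hle

end Summit.BirchSwinnertonDyer.Rank1Residual.X11b.Three.Koly

namespace Summit.BirchSwinnertonDyer.Rank1Residual.X11b.Three

open WeierstrassCurve IsDedekindDomain NumberField Literature.NumberTheory.EllipticCurves
  Literature.NumberTheory.EllipticCurves.ModularForms
  Literature.NumberTheory.EllipticCurves.Rank1Residual
  Literature.NumberTheory.EllipticCurves.Rank1Residual.Typed
  Literature.NumberTheory.GaloisRepresentations Literature.NumberTheory.GaloisCohomology
  Summit.BirchSwinnertonDyer.Rank1Residual Summit.BirchSwinnertonDyer.Rank1Residual.X11b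

/-! ### §1 The three theorems of `…UpperModEightOfTwinLower` with `hChaU` ↦ the Cassels–Tate level inputs -/

/-- **`Typed.MissingUpperBoundAt W 3` on a (T4″)@3 corner curve from the Jetchev direction AT A SUPPLIED FRAME with `d_K ≡ 1 (mod 8)`**
(`hJW8`) and the twin's `≥`-half there (`hF8`) — lane B g6's `missingUpperBoundAt_of_jetchevMaxModEightAt_of_twinLowerModEight` VERBATIM with
`hChaU` ↦ (`hCT`, `h37`): the structure bound at the frame is §0 (kernel). CONDITIONAL on the published binders, `hCT`, `h37`, `hJW8`, `hF8`.
-- adapted from Summits/BirchSwinnertonDyer/BirchSwinnertonDyer/Theorems/ClassRecordThreeCornerAtThreeUpperModEightOfTwinLower.lean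
[cite: Darmon2004, Thm. 3.6] [cite: Jetchev2008, Cor. 1.5 (shape)] [cite: Mazur1978, Cor. 4.1] [cite: JetchevSkinnerWan2017, §7.4.2 (eq:shaupper)]
[cite: MilneADT2006, Ch. I §6 Thm. 6.13(a)] -/
theorem missingUpperBoundAt_of_jetchevMaxModEightAt_of_twinLowerModEight_of_casselsTate [Fact (Nat.Prime 3)]
    (hGZ : ∀ (N : ℕ) [NeZero N] (W : WeierstrassCurve ℚ) (K : Type) [Field K] [NumberField K],
      gross_zagier N W K)
    (hKo : ∀ (N : ℕ) [NeZero N] (W : WeierstrassCurve ℚ) (K : Type) [Field K] [NumberField K],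
      kolyvagin N W K)
    (hGZK : rank_eq_analyticRank_of_analyticRank_le_one) (hmod : hasEntireLFunction_rat)
    (hnf : exists_isNewformOf)
    (hMaz : mazur_not_dvd_maninConstant_of_odd)
    (hrec : ∀ (N : ℕ) [NeZero N] (W : WeierstrassCurve ℚ) (K : Type) [Field K] [NumberField K],
      heegnerPointOfConductor_one_galoisConj N W K)
    (hD36 : ∀ (N : ℕ) [NeZero N] (W : WeierstrassCurve ℚ) (K : Type) [Field K] [NumberField K],
      phi_heegnerTau_mem_singularModuliField N W K)
    (hCT : ∀ (K : Type) [Field K] [NumberField K], casselsTate_levelInputs K)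
    (h37 : GrossLMS1991.prop37_2_frobeniusCongruence)
    (W : WeierstrassCurve ℚ) [W.IsElliptic] [W.IsGloballyMinimal] (hX : ClassX11b W 3)
    (hns : ¬ Surj W 3)
    (hJW8 : ∀ [NeZero (W.conductorNorm ℤ)] (K : Type) [Field K] [NumberField K]
      (Dt : ModularParametrizationData W (W.conductorNorm ℤ)) (β : ℤ) (ι : K →+* ℂ),
      ClassX11b W 3 → ¬ Surj W 3 →
      IsImaginaryQuadratic K → SatisfiesHeegnerHypothesis (W.conductorNorm ℤ) K →
      Odd (NumberField.discr K) → NumberField.discr K % 8 = 1 →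
      (4 * (W.conductorNorm ℤ : ℤ)) ∣ β ^ 2 - NumberField.discr K → ¬ (3 : ℤ) ∣ Dt.c →
      ∀ (s : ℕ), s ≤ padicValNat 3 W.tamagawaProduct →
        ∀ (n : ℕ) (d : KolyvaginHeegnerData Dt β ι n), Squarefree n →
          (∀ ℓ ∈ n.primeFactors, Zhang2014.IsKolyvaginPrime (W.conductorNorm ℤ) W K 3 ℓ ∧
            s ≤ Zhang2014.kolyvaginIndex W 3 ℓ) → Koly.PDiv d 3 s)
    (hF8 : Summit.BirchSwinnertonDyer.BirchSwinnertonDyer.Theorems.CornerTwinHalves.CornerTwinLowerModEightAt W) :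
    Typed.MissingUpperBoundAt W 3 := by
  have hNS : integral_neronScaling_of_isGloballyMinimal :=
    integral_neronScaling_of_isGloballyMinimal_holds
  obtain ⟨hr, hp2, hmult, hirr⟩ := id hX
  haveI : NeZero (W.conductorNorm ℤ) := ⟨(W.conductorNorm_pos_holds).ne'⟩
  -- the SUPPLIED frame: odd Heegner twin frame with `d_K ≡ 1 (mod 8)` and the twin's `≥`-half
  obtain ⟨K, _, _, Wd, _, _, Cd, ⟨hK, hodd, hlt, hHN, hH3, hLt, hWd⟩, hd8, qd, hqd, hv⟩ := hF8 hX hns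
  have hpd : ¬ ((3 : ℕ) : ℤ) ∣ NumberField.discr K := not_dvd_discr_of_split hK Nat.prime_three hp2 hH3
  have hμ : ¬ 3 ∣ Units.torsionOrder K := by
    haveI : IsTotallyComplex K := hK.2
    rw [Literature.NumberTheory.DiophantineGeometry.torsionOrder_eq_two_of_discr_lt hK.1 hlt]
    omega
  -- the Manin-good Heegner datum at THIS field (Mazur 1978 Cor. 4.1 + Darmon 2004 Thm. 3.6)
  obtain ⟨Dt, H, ι, P, hP, hc⟩ :=
    exists_maninDatum_of_odd hnf hMaz hNS W 3 (W.conductorNorm ℤ) K rfl hp2 hmult hirr hK hHN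
  have htam : padicValNat 3 Wd.tamagawaProduct = padicValNat 3 W.tamagawaProduct :=
    X2.padicValNat_tamagawaProduct_twist_of_heegner_of_odd W 3 hp2 K hK hodd hpd hHN Cd hWd
  have hu : padicValRat 3 (Cd.u : ℚ) = 0 :=
    padicValRat_u_eq_zero_of_twist_minimal W 3 K hK hHN hmult Cd hWd
  refine missingUpperBoundAt_of_shaIndexBound_sharp W 3 (W.conductorNorm ℤ) K Dt H ι P (hGZ _ W K)
    (hKo _ W K) hGZK hmod hK hHN hP hp2 hc hμ hr hLt Wd Cd hWd hu htam le_rfl ⟨qd, hqd, hv⟩ ?_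
  -- the SHARP bound over `K` at THIS frame, from the Jetchev direction at this frame (`d_K ≡ 1 (mod 8)`)
  intro hfin hPinf
  haveI : Finite (W.baseChange K).sha := hfin
  -- `d_K ≠ −3` (`3 ∣ N_E` splits in `K`) and `d_K ≠ −4` (`d_K` odd)
  have h3N : 3 ∣ W.conductorNorm ℤ := dvd_conductorNorm_of_classX11b hX
  have hpd' : ¬ ((3 : ℕ) : ℤ) ∣ NumberField.discr K :=
    not_dvd_discr_of_satisfiesHeegnerHypothesis hK hHN Nat.prime_three h3N
  have h3 : NumberField.discr K ≠ -3 := by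
    intro h; apply hpd'; rw [h]; exact ⟨-1, by norm_num⟩
  have h4 : NumberField.discr K ≠ -4 := by
    intro h; have := Int.odd_iff.mp hodd; omega
  -- a conductor-1 Kolyvagin–Heegner datum on the frame (Dt, H.β, ι) (Darmon 2004, Thm. 3.6)
  obtain ⟨d₁⟩ := exists_kolyvaginHeegnerData_one (hD36 _ W K) hK Dt H.β ι H.dvd_sq_sub
  -- the bottom point: P(1) = y_K = P in E(K̄) (Shimura reciprocity at conductor 1)
  have hPd : d₁.toGeomPoints d₁.derivedPoint = toGeomPoints (W.baseChange K) P :=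
    KolyvaginBottom.toGeomPoints_derivedPoint_one_eq (hrec _ W K) hK hHN hP d₁ rfl
  -- rank one (Kolyvagin) and no 3-torsion (E[3] irreducible, K imaginary quadratic)
  obtain ⟨hrank, -⟩ := hKo (W.conductorNorm ℤ) W K hK hHN ⟨Dt, H, ι, hP⟩ hPinf
  have hbot := torsionBy_eq_bot_of_isImaginaryQuadratic_of_hasIrreducibleModPGaloisRep W K hK
    Nat.prime_three hirr
  have hiv : ∀ x : (W.baseChange K).toAffine.Point, 3 • x = 0 → x = 0 := fun x hx ↦ by
    have hmem : x ∈ AddSubgroup.torsionBy (W.baseChange K).toAffine.Point ((3 : ℕ) : ℤ) := by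
      rw [mem_torsionBy_iff, natCast_zsmul]
      exact hx
    rw [hbot] at hmem
    exact hmem
  exact Koly.shaIndexBound_sharp_of_globalDivisibility_three_of_casselsTate W K (hCT K) h37 hmult hirr hK hd8
    h3 h4 hHN Dt H.β ι d₁ P hPd hPinf hrank hiv
    (hJW8 K Dt H.β ι hX hns hK hHN hodd hd8 H.dvd_sq_sub hc)

/-- **MONO-carrier corner curves: `Typed.MissingUpperBoundAt W 3` from the Jetchev MAX form on `d_K ≡ 1 (mod 8)` frames** (`hmaxW8`) and the
twin's `≥`-half at ONE such frame (`hF8`) — lane B g6's `…_of_monoCarrier_of_twinLowerModEight` VERBATIM with `hChaU` ↦ (`hCT`, `h37`).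
CONDITIONAL on `hmaxW8`, `hmono`, `hF8` and the cited facts; nothing booked. [cite: Jetchev2008, Thm. 1.4, Cor. 1.5 (shape)] -/
theorem missingUpperBoundAt_of_jetchevMaxModEightAt_of_monoCarrier_of_twinLowerModEight_of_casselsTate [Fact (Nat.Prime 3)]
    (hGZ : ∀ (N : ℕ) [NeZero N] (W : WeierstrassCurve ℚ) (K : Type) [Field K] [NumberField K],
      gross_zagier N W K)
    (hKo : ∀ (N : ℕ) [NeZero N] (W : WeierstrassCurve ℚ) (K : Type) [Field K] [NumberField K],
      kolyvagin N W K)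
    (hGZK : rank_eq_analyticRank_of_analyticRank_le_one) (hmod : hasEntireLFunction_rat)
    (hnf : exists_isNewformOf)
    (hMaz : mazur_not_dvd_maninConstant_of_odd)
    (hrec : ∀ (N : ℕ) [NeZero N] (W : WeierstrassCurve ℚ) (K : Type) [Field K] [NumberField K],
      heegnerPointOfConductor_one_galoisConj N W K)
    (hD36 : ∀ (N : ℕ) [NeZero N] (W : WeierstrassCurve ℚ) (K : Type) [Field K] [NumberField K],
      phi_heegnerTau_mem_singularModuliField N W K)
    (hCT : ∀ (K : Type) [Field K] [NumberField K], casselsTate_levelInputs K)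
    (h37 : GrossLMS1991.prop37_2_frobeniusCongruence)
    (W : WeierstrassCurve ℚ) [W.IsElliptic] [W.IsGloballyMinimal] (hX : ClassX11b W 3)
    (hns : ¬ Surj W 3)
    (hmono : ∃ v : HeightOneSpectrum (𝓞 ℚ),
      padicValNat 3 W.tamagawaProduct ≤ padicValNat 3 (W.tamagawaNumberAt v))
    (hmaxW8 : ∀ [NeZero (W.conductorNorm ℤ)] (K : Type) [Field K] [NumberField K]
      (Dt : ModularParametrizationData W (W.conductorNorm ℤ)) (β : ℤ) (ι : K →+* ℂ),
      ClassX11b W 3 → ¬ Surj W 3 →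
      IsImaginaryQuadratic K → SatisfiesHeegnerHypothesis (W.conductorNorm ℤ) K →
      Odd (NumberField.discr K) → NumberField.discr K % 8 = 1 →
      (4 * (W.conductorNorm ℤ : ℤ)) ∣ β ^ 2 - NumberField.discr K → ¬ (3 : ℤ) ∣ Dt.c →
      ∀ (v : HeightOneSpectrum (𝓞 ℚ)) (s : ℕ), s ≤ padicValNat 3 (W.tamagawaNumberAt v) →
        ∀ (n : ℕ) (d : KolyvaginHeegnerData Dt β ι n), Squarefree n →
          (∀ ℓ ∈ n.primeFactors, Zhang2014.IsKolyvaginPrime (W.conductorNorm ℤ) W K 3 ℓ ∧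
            s ≤ Zhang2014.kolyvaginIndex W 3 ℓ) → Koly.PDiv d 3 s)
    (hF8 : Summit.BirchSwinnertonDyer.BirchSwinnertonDyer.Theorems.CornerTwinHalves.CornerTwinLowerModEightAt W) :
    Typed.MissingUpperBoundAt W 3 := by
  refine missingUpperBoundAt_of_jetchevMaxModEightAt_of_twinLowerModEight_of_casselsTate hGZ hKo hGZK hmod hnf hMaz hrec
    hD36 hCT h37 W hX hns ?_ hF8
  intro _ K _ _ Dt β ι hX hns hK hHN hodd hd8 hβ hc s hs n d hn hℓ
  obtain ⟨v, hv⟩ := hmono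
  exact hmaxW8 K Dt β ι hX hns hK hHN hodd hd8 hβ hc v s (hs.trans hv) n d hn hℓ

/-- **END: on every MONO-carrier (T4″)@3 corner curve, `Typed.MissingUpperBoundAt W 3` ⟸ {(A′) Gross 1991 Prop. 3.7 (2), the canonical
Poitou–Tate feed (five-conjunct form), [GZ86 III (3.1)] image-free, the Cassels–Tate level inputs} ∪ the consumer's cited facts ∪
{`CornerTwinHalves.CornerTwinLowerModEightAt W`}** — lane B g6's END `missingUpperBoundAt_monoCarrier_of_threeNamedFacts_of_twinLowerModEight`
VERBATIM with `hChaU` ↦ `hCT` (Cha 2005 Rmk. 25 is now DERIVED at `p = 3`, this seat g11). The mono branch of `residual3_of_stubs` of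
`Cruxes/CornerAtThreeW/Lines/inert.lean` r11. CONDITIONAL on every binder; no stub is discharged; 21420 stays OPEN; nothing about any curve's BSD; T7.
-- adapted from Summits/BirchSwinnertonDyer/BirchSwinnertonDyer/Theorems/ClassRecordThreeCornerAtThreeUpperModEightOfTwinLower.lean
[cite: GrossLMS1991, Prop. 3.7 (2) (p. 240)] [cite: Nekovar2007, Prop. 4.13 (ii)] [cite: Jetchev2008, Thm. 1.4, Cor. 1.5]
[cite: McCallumLMS1991, §4 Prop. 4.4, §5 Prop. 5.2, Cor. 5.6] [cite: GrossZagier1986, III (3.1)] [cite: MilneADT2006, Ch. I, Thm. 4.10(b), Thm. 6.13(a)] -/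
theorem missingUpperBoundAt_monoCarrier_of_threeNamedFacts_of_twinLowerModEight_of_casselsTate [Fact (Nat.Prime 3)]
    -- the THREE named Literature facts of the Kolyvagin road + the Cassels–Tate level inputs
    (h37 : GrossLMS1991.prop37_2_frobeniusCongruence)
    (hPTc : ∀ (K : Type) [Field K] [NumberField K], poitouTate_selmerStructure_duality_conj K)
    (hF1 : Gross1991_heegnerPoint_sub_ratTorsion_mem_E0_imageFree)
    (hCT : ∀ (K : Type) [Field K] [NumberField K], casselsTate_levelInputs K)
    -- the consumer's cited facts
    (hGZ : ∀ (N : ℕ) [NeZero N] (W : WeierstrassCurve ℚ) (K : Type) [Field K] [NumberField K],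
      gross_zagier N W K)
    (hKo : ∀ (N : ℕ) [NeZero N] (W : WeierstrassCurve ℚ) (K : Type) [Field K] [NumberField K],
      kolyvagin N W K)
    (hGZK : rank_eq_analyticRank_of_analyticRank_le_one) (hmod : hasEntireLFunction_rat)
    (hnf : exists_isNewformOf)
    (hMaz : mazur_not_dvd_maninConstant_of_odd)
    (hrec : ∀ (N : ℕ) [NeZero N] (W : WeierstrassCurve ℚ) (K : Type) [Field K] [NumberField K],
      heegnerPointOfConductor_one_galoisConj N W K)
    (hD36 : ∀ (N : ℕ) [NeZero N] (W : WeierstrassCurve ℚ) (K : Type) [Field K] [NumberField K],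
      phi_heegnerTau_mem_singularModuliField N W K)
    -- the curve: a MONO-carrier (T4″)@3 corner curve, and the twin's `≥`-half at ONE `d_K ≡ 1 (mod 8)` frame
    (W : WeierstrassCurve ℚ) [W.IsElliptic] [W.IsGloballyMinimal] (hX : ClassX11b W 3)
    (hns : ¬ Surj W 3)
    (hmono : ∃ v : HeightOneSpectrum (𝓞 ℚ),
      padicValNat 3 W.tamagawaProduct ≤ padicValNat 3 (W.tamagawaNumberAt v))
    (hF8 : Summit.BirchSwinnertonDyer.BirchSwinnertonDyer.Theorems.CornerTwinHalves.CornerTwinLowerModEightAt W) :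
    Typed.MissingUpperBoundAt W 3 :=
  missingUpperBoundAt_of_jetchevMaxModEightAt_of_monoCarrier_of_twinLowerModEight_of_casselsTate hGZ hKo hGZK hmod hnf hMaz
    hrec hD36 hCT h37 W hX hns hmono
    (fun K _ _ Dt β ι hX hns hK hHN hodd hd8 hβ hc v s hs n d hn hℓ ↦
      Koly.pDivThree_of_threeNamedFacts_of_discr_mod_eight h37 hPTc hF1 W K Dt β ι hX hns hK hHN hodd hd8 hβ hc
        v s hs n d hn hℓ)
    hF8

end Summit.BirchSwinnertonDyer.Rank1Residual.X11b.Three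

end
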